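import Mathlib
import HarnessLib
import Summits.Ventures.LatticeQCDFlow.Exactness.KernelSymmetryOddObservables
import Summits.Ventures.LatticeQCDFlow.Exactness.AxisPermutationSymmetry
import Summits.Ventures.LatticeQCDFlow.Scoring.HMCKernelTranslation
import Summits.Ventures.LatticeQCDFlow.Scoring.HMCKernelAxisPermutation
import Summits.Ventures.LatticeQCDFlow.Scoring.WilsonFlowRK3Reflection
import Summits.Ventures.LatticeQCDFlow.Scoring.WilsonFlowAxisPermutationCovariance
import Summits.Ventures.LatticeQCDFlow.Scoring.CloverDensityMeanZero

/-!
# The flowed clover energy density `E` (row 21's `t²E`) under the lattice symmetries: translation and axis-permutation covariant, reflection EVEN; homogeneous one-point function and zero cross-moments with the charge at every HMC step and every lag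

HONEST FRAMING: exact (Metropolis-corrected) sampling algorithms for lattice gauge theory;
figures of merit are autocorrelation/cost numbers at stated couplings and volumes; no
continuum-physics claim.

Venture `LatticeQCDFlow` (cell pub-lqcd), sub-topic `Scoring`, FANOUT row 21 (`su3-base`: the baselines report `τ_int(t²E)` of
the lattice-averaged flowed clover energy next to `τ_int(Q)` and `τ_int(Q²)`).  NEW WORK of the cell; def-free; nothing is cited as
a fact; no number.  The Literature's `flowedCloverEnergy ρ 0 x` (`Σ_{μ<ν} Re tr(G_{μν}(x)ᴴ G_{μν}(x))`, `LatticeWilsonFlow`) is the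
observable; its parity under an abstract time reflection is the Literature's `flowedCloverEnergy_zero_reflect`
(`CloverPseudoscalarParity`).  What the tree has for the CHARGE density (`cloverPseudoscalar`: row 16's
`cloverPseudoscalar_negReflect` / `_torusConfigShift`, row 21's `cloverPseudoscalar_configPerm_swap`) is done here for the ENERGY
density, and the consequences for arm E2's chain (row 16's `hmcKernel B β ε w`) are read off row 21's `HMCKernelTranslation`,
`HMCKernelAxisPermutation` and `KernelSymmetryOddObservables` (whose header lists "the flowed energy is even" as the intended
instance but proves only the `Q`–`Q²` one).

## What is here

* §1 a symmetric double sum over `μ < ν` is invariant under relabelling the axes (`sum_ite_lt_comp_perm`).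
* §2 the bare clover energy density (`t = 0`, any group, any `L`): **`flowedCloverEnergy_zero_torusConfigShift`**
  (`E_x(τ_v U) = E_{x−v}(U)`), **`flowedCloverEnergy_zero_negReflect`** (`E_x(Θ'U) = E_{θ'x}(U)` — EVEN, where the charge
  density is odd), **`flowedCloverEnergy_zero_configPerm`** (`E_x(U ∘ E_π) = E_{π⁻¹x}(U)` for EVERY axis permutation `π`,
  unitary `ρ`; uses `C_{νμ} = −C_{μν}`); the lattice sum `Σ_x E_x` is invariant under all three.
* §3 the MEASURED observable `E_x ∘ RK3_{ε'}^m` (row 16's `wilsonFlowRK3`, `SU(n)`, fundamental representation): the same three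
  laws (`rk3CloverEnergy_torusConfigShift / _negReflect / _configPerm`) and the invariance of its lattice sum
  (`sum_rk3CloverEnergy_negReflect` etc.); the exact-flow spelling `E_x ∘ wilsonFlow t` likewise.
* §4 ARM E2 AT EVERY STEP (any coupling, MD step, kick–drift word; cold or hot start or any start with the symmetry):
  **`integral_hmcChain_rk3CloverEnergy_eq_origin`** — the one-point function of the measured energy density is homogeneous,
  `E_N[E_x] = E_N[E_0]`, so the lattice-averaged `t²E` of the run has the single-site expectation
  (`integral_hmcChain_rk3CloverEnergyAverage_eq`); **`rk3CloverCharge_mul_nHit_energy_eq_zero`** /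
  **`rk3CloverEnergy_mul_nHit_charge_eq_zero`** — under every `Θ'`-invariant law the measured charge `Q` and the measured
  total energy `Σ_x E_x` have ZERO lagged cross-moment at every lag, in both orders; chain / cold / hot corollaries.
  Reading: the `(Q, t²E)` block of the lagged covariance matrix of the run vanishes identically — `τ_int(t²E)` is a property
  of the even sector, like `τ_int(Q²)`.
NOT CLAIMED: arm E1 (ordered sweeps are not `Θ'`-symmetric as products); stationarity; any relation between `τ_int(t²E)` and
`τ_int(Q²)`; numbers.
-/

noncomputable section

open MeasureTheory ProbabilityTheory Matrix
open Literature.MathematicalPhysics.QuantumFieldTheory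
open Literature.MathematicalPhysics.QuantumFieldTheory.Luscher2010 (SuBasis)
open Literature.MathematicalPhysics.QuantumLattice (fundamentalRep fundamentalRep_mem_unitaryGroup cloverPseudoscalar
  flowedClover flowedCloverEnergy flowedClover_zero flowedClover_swap flowedCloverEnergy_zero_reflect cloverLeafSum)
open Summit.Ventures.LatticeQCDFlow.Exactness (nHit conjKernel flowedClover_zero_configPerm
  integral_mul_nHit_eq_zero_of_odd_even integral_mul_nHit_eq_zero_of_even_odd)

namespace Summit.Ventures.LatticeQCDFlow.Scoring

/-! ## §1 A symmetric double sum over `μ < ν` does not see a relabelling of the axes -/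

section Combinatorics

variable {d : ℕ}

/-- `Σ_{μ<ν} g μ ν = ½ Σ_{μ≠ν} g μ ν` for a symmetric `g`. -/
theorem sum_ite_lt_eq_half_sum_ite_ne (g : Fin d → Fin d → ℝ) (hg : ∀ a b, g b a = g a b) :
    (∑ μ, ∑ ν, if μ < ν then g μ ν else 0) = (1 / 2) * ∑ μ, ∑ ν, if μ ≠ ν then g μ ν else 0 := by
  have hsplit : (∑ μ, ∑ ν, if μ ≠ ν then g μ ν else 0) =
      (∑ μ, ∑ ν, if μ < ν then g μ ν else 0) + ∑ μ, ∑ ν, if ν < μ then g μ ν else 0 := by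
    rw [← Finset.sum_add_distrib]
    refine Finset.sum_congr rfl fun μ _ => ?_
    rw [← Finset.sum_add_distrib]
    refine Finset.sum_congr rfl fun ν _ => ?_
    rcases lt_trichotomy μ ν with hlt | heq | hgt
    · rw [if_pos hlt.ne, if_pos hlt, if_neg (not_lt.2 hlt.le), add_zero]
    · rw [if_neg (fun h => h heq), if_neg (heq ▸ lt_irrefl μ), if_neg (heq ▸ lt_irrefl μ), add_zero]
    · rw [if_pos hgt.ne', if_neg (not_lt.2 hgt.le), if_pos hgt, zero_add]
  have hswap : (∑ μ, ∑ ν, if ν < μ then g μ ν else 0) = ∑ μ, ∑ ν, if μ < ν then g μ ν else 0 := by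
    rw [Finset.sum_comm]
    refine Finset.sum_congr rfl fun μ _ => Finset.sum_congr rfl fun ν _ => ?_
    rw [hg]
  rw [hsplit, hswap]
  ring

/-- **`Σ_{μ<ν} g (σμ) (σν) = Σ_{μ<ν} g μ ν`** for a symmetric `g` and any permutation `σ` of the axes. -/
theorem sum_ite_lt_comp_perm (g : Fin d → Fin d → ℝ) (hg : ∀ a b, g b a = g a b) (σ : Equiv.Perm (Fin d)) :
    (∑ μ, ∑ ν, if μ < ν then g (σ μ) (σ ν) else 0) = ∑ μ, ∑ ν, if μ < ν then g μ ν else 0 := by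
  rw [sum_ite_lt_eq_half_sum_ite_ne (fun μ ν => g (σ μ) (σ ν)) (fun a b => hg _ _), sum_ite_lt_eq_half_sum_ite_ne g hg]
  congr 1
  have hne : ∀ μ ν : Fin d, (if μ ≠ ν then g (σ μ) (σ ν) else 0) = if σ μ ≠ σ ν then g (σ μ) (σ ν) else 0 := by
    intro μ ν
    simp only [ne_eq, σ.injective.eq_iff]
  simp only [hne]
  exact Fintype.sum_equiv σ _ _ fun μ => Fintype.sum_equiv σ _ _ fun ν => rfl

end Combinatorics

/-! ## §2 The bare clover energy density under translations, the time reflection and axis permutations -/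

section Bare

variable {d L N : ℕ} {G : Type*} [Group G] (ρ : G →* Matrix (Fin N) (Fin N) ℂ)

/-- **Translation covariance**: `E_x(τ_v U) = E_{x−v}(U)` for the torus translation `τ_v U = (e ↦ U(e − v))`. -/
theorem flowedCloverEnergy_zero_torusConfigShift [MeasurableSpace G] (v x : Site d L) (U : GaugeConfig d L G) :
    flowedCloverEnergy ρ 0 x (TorusTranslation.torusConfigShift v U) = flowedCloverEnergy ρ 0 (x - v) U := by
  have key : ∀ μ ν : Fin d,
      flowedClover ρ 0 (TorusTranslation.torusConfigShift v U : GaugeConfig d L G) x μ ν = flowedClover ρ 0 U (x - v) μ ν := by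
    intro μ ν
    rw [flowedClover_zero, flowedClover_zero]
    simp only [TorusTranslation.torusConfigShift_apply]
    exact congrArg _ (congrArg _ (cloverLeafSum_translate (fun e => ρ (U e)) v x μ ν))
  simp only [flowedCloverEnergy, key]

/-- Hence the lattice-summed energy is translation invariant: `Σ_x E_x(τ_v U) = Σ_x E_x(U)`. -/
theorem sum_flowedCloverEnergy_zero_torusConfigShift [MeasurableSpace G] [NeZero L] (v : Site d L) (U : GaugeConfig d L G) :
    ∑ x : Site d L, flowedCloverEnergy ρ 0 x (TorusTranslation.torusConfigShift v U) =
      ∑ x : Site d L, flowedCloverEnergy ρ 0 x U := by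
  simp only [flowedCloverEnergy_zero_torusConfigShift]
  exact Fintype.sum_equiv (Equiv.subRight v) _ _ fun x => rfl

/-- **The energy density is EVEN under the time reflection**: `E_x(Θ'U) = E_{θ'x}(U)` for a unitary `ρ` (the Literature's
`flowedCloverEnergy_zero_reflect` with `θ = Site.negReflect`; contrast row 16's `cloverPseudoscalar_negReflect`, odd). -/
theorem flowedCloverEnergy_zero_negReflect [NeZero d] (hρu : ∀ g, ρ g ∈ Matrix.unitaryGroup (Fin N) ℂ) (x : Site d L)
    (U : GaugeConfig d L G) :
    flowedCloverEnergy ρ 0 x U.negReflect = flowedCloverEnergy ρ 0 x.negReflect U :=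
  flowedCloverEnergy_zero_reflect ρ hρu (R := ZMod L) Site.negReflect negReflect_add_single_zero
    (fun y _ hi => negReflect_add_single_of_ne y hi) U U.negReflect (negReflect_apply_zero U)
    (fun y _ hi => negReflect_apply_of_ne U y hi) x

/-- Hence the lattice-summed energy is reflection invariant: `Σ_x E_x(Θ'U) = Σ_x E_x(U)`. -/
theorem sum_flowedCloverEnergy_zero_negReflect [NeZero d] [NeZero L] (hρu : ∀ g, ρ g ∈ Matrix.unitaryGroup (Fin N) ℂ)
    (U : GaugeConfig d L G) :
    ∑ x : Site d L, flowedCloverEnergy ρ 0 x U.negReflect = ∑ x : Site d L, flowedCloverEnergy ρ 0 x U := by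
  simp only [flowedCloverEnergy_zero_negReflect ρ hρu]
  exact Fintype.sum_equiv (Function.Involutive.toPerm (Site.negReflect (d := d) (L := L))
    WilsonSiteRP.negReflect_negReflect) _ _ fun x => rfl

/-- **Axis-permutation covariance**: `E_x(U ∘ E_π) = E_{π⁻¹ x}(U)` for EVERY permutation `π` of the four axes and unitary `ρ`
(the clovers go to `C_{π⁻¹μ,π⁻¹ν}(π⁻¹x)`, row 21's `flowedClover_zero_configPerm`; the sum over planes is relabelled with
`C_{νμ} = −C_{μν}`). -/
theorem flowedCloverEnergy_zero_configPerm [MeasurableSpace G] (hρu : ∀ g, ρ g ∈ Matrix.unitaryGroup (Fin N) ℂ) (π : Equiv.Perm (Fin 4))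
    (x : Site 4 L) (U : GaugeConfig 4 L G) :
    flowedCloverEnergy ρ 0 x (configPerm π U) = flowedCloverEnergy ρ 0 (sitePerm π.symm x) U := by
  unfold flowedCloverEnergy
  simp only [flowedClover_zero_configPerm]
  refine sum_ite_lt_comp_perm
    (fun a b => ((flowedClover ρ 0 U (sitePerm π.symm x) a b)ᴴ * flowedClover ρ 0 U (sitePerm π.symm x) a b).trace.re)
    (fun a b => ?_) π.symm
  simp only [flowedClover_swap ρ hρu 0 U _ a b, conjTranspose_neg, neg_mul_neg]

/-- Hence the lattice-summed energy is invariant under every axis permutation. -/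
theorem sum_flowedCloverEnergy_zero_configPerm [MeasurableSpace G] [NeZero L] (hρu : ∀ g, ρ g ∈ Matrix.unitaryGroup (Fin N) ℂ) (π : Equiv.Perm (Fin 4))
    (U : GaugeConfig 4 L G) :
    ∑ x : Site 4 L, flowedCloverEnergy ρ 0 x (configPerm π U) = ∑ x : Site 4 L, flowedCloverEnergy ρ 0 x U := by
  simp only [flowedCloverEnergy_zero_configPerm ρ hρu]
  exact Fintype.sum_equiv (sitePerm (L := L) π.symm) _ _ fun x => rfl

end Bare

/-! ## §3 The measured observable `E_x ∘ RK3^m` (and `E_x ∘ wilsonFlow t`) -/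

section Measured

variable {L n : ℕ}

/-- `E_x(RK3^m(τ_v U)) = E_{x−v}(RK3^m U)`. -/
theorem rk3CloverEnergy_torusConfigShift (ε : ℝ) (m : ℕ) (v x : Site 4 L)
    (U : GaugeConfig 4 L (Matrix.specialUnitaryGroup (Fin n) ℂ)) :
    flowedCloverEnergy (fundamentalRep (Fin n)) 0 x ((wilsonFlowRK3 ε)^[m] (TorusTranslation.torusConfigShift v U)) =
      flowedCloverEnergy (fundamentalRep (Fin n)) 0 (x - v) ((wilsonFlowRK3 ε)^[m] U) := by
  rw [iterate_wilsonFlowRK3_torusConfigShift, flowedCloverEnergy_zero_torusConfigShift]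

/-- `E_x(RK3^m(Θ'U)) = E_{θ'x}(RK3^m U)`: the measured energy density is even. -/
theorem rk3CloverEnergy_negReflect (ε : ℝ) (m : ℕ) (x : Site 4 L)
    (U : GaugeConfig 4 L (Matrix.specialUnitaryGroup (Fin n) ℂ)) :
    flowedCloverEnergy (fundamentalRep (Fin n)) 0 x ((wilsonFlowRK3 ε)^[m] U.negReflect) =
      flowedCloverEnergy (fundamentalRep (Fin n)) 0 x.negReflect ((wilsonFlowRK3 ε)^[m] U) := by
  rw [iterate_wilsonFlowRK3_negReflect, flowedCloverEnergy_zero_negReflect _ fundamentalRep_mem_unitaryGroup]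

/-- `E_x(RK3^m(U ∘ E_π)) = E_{π⁻¹x}(RK3^m U)` for every axis permutation. -/
theorem rk3CloverEnergy_configPerm (π : Equiv.Perm (Fin 4)) (ε : ℝ) (m : ℕ) (x : Site 4 L)
    (U : GaugeConfig 4 L (Matrix.specialUnitaryGroup (Fin n) ℂ)) :
    flowedCloverEnergy (fundamentalRep (Fin n)) 0 x ((wilsonFlowRK3 ε)^[m] (configPerm π U)) =
      flowedCloverEnergy (fundamentalRep (Fin n)) 0 (sitePerm π.symm x) ((wilsonFlowRK3 ε)^[m] U) := by
  rw [iterate_wilsonFlowRK3_configPerm, flowedCloverEnergy_zero_configPerm _ fundamentalRep_mem_unitaryGroup]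

variable [NeZero L]

/-- **The measured TOTAL energy `Σ_x E_x ∘ RK3^m` is `Θ'`-invariant** (even observable of arm E2's symmetry). -/
theorem sum_rk3CloverEnergy_negReflect (ε : ℝ) (m : ℕ) (U : GaugeConfig 4 L (Matrix.specialUnitaryGroup (Fin n) ℂ)) :
    ∑ x : Site 4 L, flowedCloverEnergy (fundamentalRep (Fin n)) 0 x ((wilsonFlowRK3 ε)^[m] U.negReflect) =
      ∑ x : Site 4 L, flowedCloverEnergy (fundamentalRep (Fin n)) 0 x ((wilsonFlowRK3 ε)^[m] U) := by
  rw [iterate_wilsonFlowRK3_negReflect, sum_flowedCloverEnergy_zero_negReflect _ fundamentalRep_mem_unitaryGroup]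

/-- The measured total energy is translation invariant. -/
theorem sum_rk3CloverEnergy_torusConfigShift (ε : ℝ) (m : ℕ) (v : Site 4 L)
    (U : GaugeConfig 4 L (Matrix.specialUnitaryGroup (Fin n) ℂ)) :
    ∑ x : Site 4 L, flowedCloverEnergy (fundamentalRep (Fin n)) 0 x ((wilsonFlowRK3 ε)^[m] (TorusTranslation.torusConfigShift v U)) =
      ∑ x : Site 4 L, flowedCloverEnergy (fundamentalRep (Fin n)) 0 x ((wilsonFlowRK3 ε)^[m] U) := by
  rw [iterate_wilsonFlowRK3_torusConfigShift, sum_flowedCloverEnergy_zero_torusConfigShift]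

/-- The measured total energy is invariant under every axis permutation. -/
theorem sum_rk3CloverEnergy_configPerm (π : Equiv.Perm (Fin 4)) (ε : ℝ) (m : ℕ)
    (U : GaugeConfig 4 L (Matrix.specialUnitaryGroup (Fin n) ℂ)) :
    ∑ x : Site 4 L, flowedCloverEnergy (fundamentalRep (Fin n)) 0 x ((wilsonFlowRK3 ε)^[m] (configPerm π U)) =
      ∑ x : Site 4 L, flowedCloverEnergy (fundamentalRep (Fin n)) 0 x ((wilsonFlowRK3 ε)^[m] U) := by
  rw [iterate_wilsonFlowRK3_configPerm, sum_flowedCloverEnergy_zero_configPerm _ fundamentalRep_mem_unitaryGroup]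

/-- Exact-flow spelling: `E_x(V_t(Θ'U)) = E_{θ'x}(V_t U)`. -/
theorem flowedCloverEnergy_wilsonFlow_negReflect (t : ℝ) (x : Site 4 L)
    (U : GaugeConfig 4 L (Matrix.specialUnitaryGroup (Fin n) ℂ)) :
    flowedCloverEnergy (fundamentalRep (Fin n)) 0 x (wilsonFlow t U.negReflect) =
      flowedCloverEnergy (fundamentalRep (Fin n)) 0 x.negReflect (wilsonFlow t U) := by
  rw [wilsonFlow_negReflect, flowedCloverEnergy_zero_negReflect _ fundamentalRep_mem_unitaryGroup]

/-- Exact-flow spelling: `E_x(V_t(τ_v U)) = E_{x−v}(V_t U)`. -/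
theorem flowedCloverEnergy_wilsonFlow_torusConfigShift (t : ℝ) (v x : Site 4 L)
    (U : GaugeConfig 4 L (Matrix.specialUnitaryGroup (Fin n) ℂ)) :
    flowedCloverEnergy (fundamentalRep (Fin n)) 0 x (wilsonFlow t (TorusTranslation.torusConfigShift v U)) =
      flowedCloverEnergy (fundamentalRep (Fin n)) 0 (x - v) (wilsonFlow t U) := by
  rw [wilsonFlow_torusConfigShift, flowedCloverEnergy_zero_torusConfigShift]

/-- Exact-flow spelling: `E_x(V_t(U ∘ E_π)) = E_{π⁻¹x}(V_t U)`. -/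
theorem flowedCloverEnergy_wilsonFlow_configPerm (π : Equiv.Perm (Fin 4)) (t : ℝ) (x : Site 4 L)
    (U : GaugeConfig 4 L (Matrix.specialUnitaryGroup (Fin n) ℂ)) :
    flowedCloverEnergy (fundamentalRep (Fin n)) 0 x (wilsonFlow t (configPerm π U)) =
      flowedCloverEnergy (fundamentalRep (Fin n)) 0 (sitePerm π.symm x) (wilsonFlow t U) := by
  rw [wilsonFlow_configPerm, flowedCloverEnergy_zero_configPerm _ fundamentalRep_mem_unitaryGroup]

end Measured

/-! ## §4 Arm E2: homogeneous one-point function and zero `(Q, E)` cross-moments at every step and every lag -/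

section ArmE2

variable {L n : ℕ} [NeZero L] (B : SuBasis n) (β ε : ℝ) (w : List MDOp)

/-- **`E_N[E_x] = E_N[E_0]` AT EVERY HMC STEP** from any translation-invariant start: the one-point function of the measured
energy density is homogeneous. -/
theorem integral_hmcChain_rk3CloverEnergy_eq_origin {μ₀ : Measure (GaugeConfig 4 L (Matrix.specialUnitaryGroup (Fin n) ℂ))}
    (hT : ∀ v : Site 4 L, μ₀.map (TorusTranslation.torusConfigShift v) = μ₀) (N : ℕ) (ε' : ℝ) (m : ℕ) (x : Site 4 L) :
    ∫ U, flowedCloverEnergy (fundamentalRep (Fin n)) 0 x ((wilsonFlowRK3 ε')^[m] U) ∂(μ₀.bind (nHit (hmcKernel B β ε w) N)) =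
      ∫ U, flowedCloverEnergy (fundamentalRep (Fin n)) 0 0 ((wilsonFlowRK3 ε')^[m] U) ∂(μ₀.bind (nHit (hmcKernel B β ε w) N)) := by
  have h := integral_hmcChain_comp_torusConfigShift B β ε w x (hT x) N
    (fun U => flowedCloverEnergy (fundamentalRep (Fin n)) 0 x ((wilsonFlowRK3 ε')^[m] U))
  simp only [rk3CloverEnergy_torusConfigShift, sub_self] at h
  exact h.symm

/-- **The lattice-AVERAGED measured energy (`t²E` of the run, up to the factor `t²`) has the single-site expectation at every
step**, for every nonempty finite set of sites, provided the site terms are integrable for the `N`-step law. -/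
theorem integral_hmcChain_rk3CloverEnergyAverage_eq {μ₀ : Measure (GaugeConfig 4 L (Matrix.specialUnitaryGroup (Fin n) ℂ))}
    (hT : ∀ v : Site 4 L, μ₀.map (TorusTranslation.torusConfigShift v) = μ₀) (N : ℕ) (ε' : ℝ) (m : ℕ)
    (S : Finset (Site 4 L)) (hS : S.Nonempty)
    (hint : ∀ x ∈ S, Integrable (fun U : GaugeConfig 4 L (Matrix.specialUnitaryGroup (Fin n) ℂ) =>
      flowedCloverEnergy (fundamentalRep (Fin n)) 0 x ((wilsonFlowRK3 ε')^[m] U)) (μ₀.bind (nHit (hmcKernel B β ε w) N))) :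
    ∫ U, (S.card : ℝ)⁻¹ * ∑ x ∈ S, flowedCloverEnergy (fundamentalRep (Fin n)) 0 x ((wilsonFlowRK3 ε')^[m] U)
        ∂(μ₀.bind (nHit (hmcKernel B β ε w) N)) =
      ∫ U, flowedCloverEnergy (fundamentalRep (Fin n)) 0 0 ((wilsonFlowRK3 ε')^[m] U) ∂(μ₀.bind (nHit (hmcKernel B β ε w) N)) := by
  rw [integral_const_mul, integral_finsetSum S hint]
  rw [Finset.sum_congr rfl fun x _ => integral_hmcChain_rk3CloverEnergy_eq_origin B β ε w hT N ε' m x, Finset.sum_const,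
    nsmul_eq_mul, ← mul_assoc, inv_mul_cancel₀ (Nat.cast_ne_zero.2 (Finset.card_pos.2 hS).ne'), one_mul]

/-- Cold start (`U ≡ 1`): `E_N[E_x] = E_N[E_0]` at every step. -/
theorem integral_hmcColdStart_rk3CloverEnergy_eq_origin (N : ℕ) (ε' : ℝ) (m : ℕ) (x : Site 4 L) :
    ∫ U, flowedCloverEnergy (fundamentalRep (Fin n)) 0 x ((wilsonFlowRK3 ε')^[m] U)
        ∂((Measure.dirac (1 : GaugeConfig 4 L (Matrix.specialUnitaryGroup (Fin n) ℂ))).bind (nHit (hmcKernel B β ε w) N)) =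
      ∫ U, flowedCloverEnergy (fundamentalRep (Fin n)) 0 0 ((wilsonFlowRK3 ε')^[m] U)
        ∂((Measure.dirac (1 : GaugeConfig 4 L (Matrix.specialUnitaryGroup (Fin n) ℂ))).bind (nHit (hmcKernel B β ε w) N)) :=
  integral_hmcChain_rk3CloverEnergy_eq_origin B β ε w dirac_one_map_torusConfigShift N ε' m x

/-- Hot start (`∏ dHaar`): `E_N[E_x] = E_N[E_0]` at every step. -/
theorem integral_hmcHotStart_rk3CloverEnergy_eq_origin (N : ℕ) (ε' : ℝ) (m : ℕ) (x : Site 4 L) :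
    ∫ U, flowedCloverEnergy (fundamentalRep (Fin n)) 0 x ((wilsonFlowRK3 ε')^[m] U)
        ∂((Measure.pi fun _ : Edge 4 L => haarProbability (Matrix.specialUnitaryGroup (Fin n) ℂ)).bind
          (nHit (hmcKernel B β ε w) N)) =
      ∫ U, flowedCloverEnergy (fundamentalRep (Fin n)) 0 0 ((wilsonFlowRK3 ε')^[m] U)
        ∂((Measure.pi fun _ : Edge 4 L => haarProbability (Matrix.specialUnitaryGroup (Fin n) ℂ)).bind
          (nHit (hmcKernel B β ε w) N)) :=
  integral_hmcChain_rk3CloverEnergy_eq_origin B β ε w piHaar_map_torusConfigShift N ε' m x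

/-- **`E_ν[Q(U) · (κᵏ ΣE)(U)] = 0` at every lag** under every `Θ'`-invariant law `ν`: the measured charge (odd) and the measured
total energy (even) have zero lagged cross-moment for arm E2's kernel. -/
theorem rk3CloverCharge_mul_nHit_energy_eq_zero {ν : Measure (GaugeConfig 4 L (Matrix.specialUnitaryGroup (Fin n) ℂ))}
    (hν : ν.map GaugeConfig.negReflect = ν) (k : ℕ) (ε' : ℝ) (m : ℕ) (ε'' : ℝ) (m' : ℕ) :
    ∫ U, (∑ x : Site 4 L, cloverPseudoscalar (fundamentalRep (Fin n)) x ((wilsonFlowRK3 ε')^[m] U)) *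
        (∫ V, (∑ x : Site 4 L, flowedCloverEnergy (fundamentalRep (Fin n)) 0 x ((wilsonFlowRK3 ε'')^[m'] V))
          ∂(nHit (hmcKernel B β ε w) k U)) ∂ν = 0 :=
  integral_mul_nHit_eq_zero_of_odd_even (θ := WilsonSiteRP.negReflectEquiv) (conjKernel_hmcKernel B β ε w) hν
    (fun U => sum_cloverPseudoscalar_iterate_wilsonFlowRK3_negReflect ε' m U)
    (fun U => sum_rk3CloverEnergy_negReflect ε'' m' U) k

/-- **And in the other order: `E_ν[(ΣE)(U) · (κᵏ Q)(U)] = 0` at every lag.** -/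
theorem rk3CloverEnergy_mul_nHit_charge_eq_zero {ν : Measure (GaugeConfig 4 L (Matrix.specialUnitaryGroup (Fin n) ℂ))}
    (hν : ν.map GaugeConfig.negReflect = ν) (k : ℕ) (ε' : ℝ) (m : ℕ) (ε'' : ℝ) (m' : ℕ) :
    ∫ U, (∑ x : Site 4 L, flowedCloverEnergy (fundamentalRep (Fin n)) 0 x ((wilsonFlowRK3 ε'')^[m'] U)) *
        (∫ V, (∑ x : Site 4 L, cloverPseudoscalar (fundamentalRep (Fin n)) x ((wilsonFlowRK3 ε')^[m] V))
          ∂(nHit (hmcKernel B β ε w) k U)) ∂ν = 0 :=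
  integral_mul_nHit_eq_zero_of_even_odd (θ := WilsonSiteRP.negReflectEquiv) (conjKernel_hmcKernel B β ε w) hν
    (fun U => sum_rk3CloverEnergy_negReflect ε'' m' U)
    (fun U => sum_cloverPseudoscalar_iterate_wilsonFlowRK3_negReflect ε' m U) k

/-- **At every step `N` and lag `k` of the run** from any `Θ'`-invariant start: `E[Q(U_N) · ΣE(U_{N+k})] = 0`. -/
theorem rk3CloverCharge_mul_nHit_energy_hmcChain_eq_zero
    {μ₀ : Measure (GaugeConfig 4 L (Matrix.specialUnitaryGroup (Fin n) ℂ))} (hμ₀ : μ₀.map GaugeConfig.negReflect = μ₀)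
    (N k : ℕ) (ε' : ℝ) (m : ℕ) (ε'' : ℝ) (m' : ℕ) :
    ∫ U, (∑ x : Site 4 L, cloverPseudoscalar (fundamentalRep (Fin n)) x ((wilsonFlowRK3 ε')^[m] U)) *
        (∫ V, (∑ x : Site 4 L, flowedCloverEnergy (fundamentalRep (Fin n)) 0 x ((wilsonFlowRK3 ε'')^[m'] V))
          ∂(nHit (hmcKernel B β ε w) k U)) ∂(μ₀.bind (nHit (hmcKernel B β ε w) N)) = 0 :=
  rk3CloverCharge_mul_nHit_energy_eq_zero B β ε w (map_bind_nHit_eq_self (conjKernel_hmcKernel B β ε w) hμ₀ N) k ε' m ε'' m'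

/-- The other order along the run: `E[ΣE(U_N) · Q(U_{N+k})] = 0`. -/
theorem rk3CloverEnergy_mul_nHit_charge_hmcChain_eq_zero
    {μ₀ : Measure (GaugeConfig 4 L (Matrix.specialUnitaryGroup (Fin n) ℂ))} (hμ₀ : μ₀.map GaugeConfig.negReflect = μ₀)
    (N k : ℕ) (ε' : ℝ) (m : ℕ) (ε'' : ℝ) (m' : ℕ) :
    ∫ U, (∑ x : Site 4 L, flowedCloverEnergy (fundamentalRep (Fin n)) 0 x ((wilsonFlowRK3 ε'')^[m'] U)) *
        (∫ V, (∑ x : Site 4 L, cloverPseudoscalar (fundamentalRep (Fin n)) x ((wilsonFlowRK3 ε')^[m] V))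
          ∂(nHit (hmcKernel B β ε w) k U)) ∂(μ₀.bind (nHit (hmcKernel B β ε w) N)) = 0 :=
  rk3CloverEnergy_mul_nHit_charge_eq_zero B β ε w (map_bind_nHit_eq_self (conjKernel_hmcKernel B β ε w) hμ₀ N) k ε' m ε'' m'

/-- Cold start: `E[Q(U_N) · ΣE(U_{N+k})] = 0` for every `N`, `k`. -/
theorem rk3CloverCharge_mul_nHit_energy_hmcColdStart_eq_zero (N k : ℕ) (ε' : ℝ) (m : ℕ) (ε'' : ℝ) (m' : ℕ) :
    ∫ U, (∑ x : Site 4 L, cloverPseudoscalar (fundamentalRep (Fin n)) x ((wilsonFlowRK3 ε')^[m] U)) *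
        (∫ V, (∑ x : Site 4 L, flowedCloverEnergy (fundamentalRep (Fin n)) 0 x ((wilsonFlowRK3 ε'')^[m'] V))
          ∂(nHit (hmcKernel B β ε w) k U))
      ∂((Measure.dirac (1 : GaugeConfig 4 L (Matrix.specialUnitaryGroup (Fin n) ℂ))).bind (nHit (hmcKernel B β ε w) N)) = 0 :=
  rk3CloverCharge_mul_nHit_energy_hmcChain_eq_zero B β ε w dirac_one_map_negReflect N k ε' m ε'' m'

/-- Hot start: `E[Q(U_N) · ΣE(U_{N+k})] = 0` for every `N`, `k`. -/
theorem rk3CloverCharge_mul_nHit_energy_hmcHotStart_eq_zero (N k : ℕ) (ε' : ℝ) (m : ℕ) (ε'' : ℝ) (m' : ℕ) :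
    ∫ U, (∑ x : Site 4 L, cloverPseudoscalar (fundamentalRep (Fin n)) x ((wilsonFlowRK3 ε')^[m] U)) *
        (∫ V, (∑ x : Site 4 L, flowedCloverEnergy (fundamentalRep (Fin n)) 0 x ((wilsonFlowRK3 ε'')^[m'] V))
          ∂(nHit (hmcKernel B β ε w) k U))
      ∂((Measure.pi fun _ : Edge 4 L => haarProbability (Matrix.specialUnitaryGroup (Fin n) ℂ)).bind
        (nHit (hmcKernel B β ε w) N)) = 0 :=
  rk3CloverCharge_mul_nHit_energy_hmcChain_eq_zero B β ε w piHaar_map_negReflect N k ε' m ε'' m'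

end ArmE2

end Summit.Ventures.LatticeQCDFlow.Scoring
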